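/-
Copyright (c) 2026 the pub-hodgecm-mathlib formalisation cell (harness21).  Prover seat hodgecm-mathlib-LH4-p19 (g2), req620 Track A «(D-RAM) FOUR-FRAME» squad
(STAGE-1b, row (2) of the piece `f_{T₊}`, the (β₂) road (R-36) «PURE-CELL LEDGER»; β₂ sub-dealer LH4-p04 (g9) rows (ROW-D♭) ∕ (ROW-SMALL-2): the diagonal cell at `δ = 2`, `d = 2`
in ‹OFF.letter.v1› currency — the residue (hdflat) of ★ `small2_of_term_of_dflat`), 2026-09-05.
-/
import Summits.HodgeConjecture.HodgeConjecture.Theorems.F0P3cDyRamDiagonalCellVertexRead    -- ★ (this seat, K7c-A): the per-vertex read; brings ★ p863048, ★ K5c, ★ SmulXPlusLabel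
import Summits.HodgeConjecture.HodgeConjecture.Theorems.F0P3cDyRamDiagonalCellRowSocket     -- ★ p863270 (this seat, K7): `cellDiff_diag_eq_zero_of_reads`; brings ★ K6c, ★ FaceTubeAbove
import Summits.HodgeConjecture.HodgeConjecture.Theorems.F0P3cDyRamDiagonalCellPopRead       -- ★ p863319 (this seat, K7b): `weight_ne_zero_iff_cls_iff_of_gen`
import Summits.HodgeConjecture.HodgeConjecture.Theorems.F0P3cDyRamDiagonalCellAffineLabel   -- ★ p862875 (this seat, K4): `exists_affineLabel_of_coords`
import Summits.HodgeConjecture.HodgeConjecture.Theorems.F0P3cDyRamRowCleanCellBit          -- ★ (LH4-p06 (g9)): `line_entry_mul_map_eq_one`; brings ★ p863084 `latticeNearTransvShell_zero_of_row`, ★ p862869, ★ ConeLevelTransport, ‹OFF› vocabulary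
import Summits.HodgeConjecture.HodgeConjecture.Theorems.F0P3cDyRamBeta2ConesRowWindow       -- ★ p863007 (LH7-p10 (g2)): `isOrd_lam_iff_le`
import Summits.HodgeConjecture.HodgeConjecture.Theorems.F0P3cDyRamDiagonalFixedClassSystems -- ★ (LH4 lineage): `exists_repr_fixedBall_card` (digit systems)
import HarnessLib

/-!
# Crux `H413`, line LH4 «(D-RAM) FOUR-FRAME» — STAGE-1b, row (2), the (β₂) road (R-36), lane B, rows (ROW-D♭) ∕ (ROW-SMALL-2): «THE DIAGONAL CELL AT `δ = 2`, `d = 2`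
# CONTRIBUTES ZERO» in ‹OFF.letter.v1›'s currency — `dflat_two_holds (N) (hN)` = the hypothesis (hdflat) of ★ `small2_of_term_of_dflat`

Cell `hodgecm-mathlib` (D-0151), FLOOR 0, crux item H413 = `stmt-HodgeConjecture-24833`, route of record `HCCMUnconditional`; squad F0∕P3c∕LH4; lane
`--supports stmt-HodgeConjecture-24833 --as helper` (count-neutral; pays NO tier-0 row).  THEOREMS ONLY (no `def`, no instance, no notation, no `sorry`, default heartbeats);
★-only imports; states NO law; (β₂) stays a HYPOTHESIS.  CONCLUSION = ‹OFF.letter.v1›'s one-literal general block (binders byte-identical to ‹SMALL-2.letter.v1› c57fd95f) with the tail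
`∀ b, 1 ≤ b → 2 * b = m → d = 2 → tE < m → 4 ≤ m → jl = m + 2 → X(b,b) = 0` — the shape `hdflat` of ★ p863420 `small2_of_term_of_dflat` VERBATIM — universally closed over the
fence schema `N` with the ONE floor hypothesis `hN : ∀ d tE q, 4 ≤ N d tE q` (N-discipline; the deep tokens `_hlam1`, `_hu1N` are used at depth `4 = 3d − 2 + d%2`).

WHY (memo MECH-LDflat; this seat's K1–K7).  ★ K7 `cellDiff_diag_eq_zero_of_reads` makes `X(b,b) = 0` follow from three reads; ★ K7b discharges (hP) (`ε :=` «`−h_W` is a norm»);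
THIS FILE discharges (hL₁)(hL₂) and assembles: per vertex (★ p862869 presentation `x₁, w₀, g₀`) the shells are LH4-p06's ★ `latticeNearTransvShell_zero_of_row` (`k = m*, m_c`;
`jl ≥ j + b + 1`), the value set is read by ★ K7c-A `valueSet_eq_xPlus_iff_affineSign` as `ω(T̂₁)·ω(α₁ + γ₁V̂₁)`, the class `ω(T̂₁)` is `ε` by ★ K7b at `x₁`, and the digit moves to the
given generator by ★ K5c + ★ K6b; every weighted member has a glued vertex (★ `ncard_glueFibre_eq_natCard_normFibre_of_gen` + `hf`, as in LH4-p06's MASTER).  The literals are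
socketed as `(P₁, Q₁) := (q⁺, q⁻)` when `ε` holds and `(q⁻, q⁺)` otherwise.  Constants: the pivot `θ₀ := αΘα` (★ K3), the coordinates `â, b̂` of `μ̂` (★ K3 `v_coords_scalar`, `g = 1`),
the affine letters (★ K4), the digit systems (★ `exists_repr_fixedBall_card`), `hFN` (★ `forall_fixed_fixed_exists_mul_theta_eq_of_frame`), `lam ∈ 𝒪_b` (★ `isOrd_lam_iff_le`).
* HEAD `dflat_two_holds`.
HONEST LABEL.  Count-neutral assembly; nothing printed is asserted; no census law is stated; (ROW-TERM) and ‹CORE› stay OPEN; `HC_CM` is proved only modulo the 7 printed citations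
(2 remaining named inputs: hLiu418 = `stmt-HodgeConjecture-24832`, h413 = `stmt-HodgeConjecture-24833`) until rung 0 closes.
## References
* [Kottwitz1986BaseChangeUnits] R. E. Kottwitz, *Base change for unit elements of Hecke algebras*, Compositio Math. 60 (1986): §1 pp. 240–241 (fixed-lattice counts).
* [Rogawski1990] J. D. Rogawski, *Automorphic Representations of Unitary Groups in Three Variables*, Ann. of Math. Stud. 123 (1990): §4.9 Prop. 4.9.1 (b) p. 55, §12.2.
* [LabesseLanglands1979] J.-P. Labesse, R. P. Langlands, *L-indistinguishability for SL(2)*, Canad. J. Math. 31 (1979): §2 (2.2) p. 9.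
* [Jacobowitz1962] R. Jacobowitz, *Hermitian forms over local fields*, Amer. J. Math. 84 (1962): §4 (dual lattices, gluing).
* [Serre1979] J.-P. Serre, *Local Fields*, GTM 67 (1979): Ch. V §3 Cor. 3 pp. 85–87, Ch. XV §2.
-/

set_option autoImplicit false

noncomputable section

namespace Summit.HodgeConjecture.HodgeConjecture.Cruxes.H413.F0P3cDyRamDiagonalCellDflatTwo

open scoped Valued WithZero Matrix MatrixGroups Classical
open WithZero
open Literature.NumberTheory.Automorphic Literature.NumberTheory.Automorphic.HermitianLattice Literature.NumberTheory.Automorphic.UnitaryLatticeTree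
open Literature.NumberTheory.Automorphic.UnitaryThreeFourFrame (IsRamifiedQuadraticDatum normSign normSign_of_isNorm normSign_of_not_isNorm)
open Literature.NumberTheory.Rogawski1990
open Literature.NumberTheory.LocalFields (isAdicComplete_valuedInteger_of_completeSpace)
open Literature.NumberTheory.LocalFields.WildQuadraticDatum (d_le_succ_t exists_mul_map_eq_of_fixed_of_v_sub_one_le_pred)
open Summit.HodgeConjecture.HodgeConjecture.Cruxes.H413.F0P3cDyRamFourFramePieces
open Summit.HodgeConjecture.HodgeConjecture.Cruxes.H413.F0P3cDyRamFourFrameCensusDefs (LatticeInLevel LatticeNearTransvShell)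
open Summit.HodgeConjecture.HodgeConjecture.Cruxes.H413.F0P3cDyRamStageOneBDefs (mcOfRecord)
open Summit.HodgeConjecture.HodgeConjecture.Cruxes.H413.F0P3cDyRamToricCensusDefs
open Summit.HodgeConjecture.HodgeConjecture.Cruxes.H413.F0P3cDyRamNormPairsIffFrames (normSign_eq_one_or)
open Summit.HodgeConjecture.HodgeConjecture.Cruxes.H413.F0P3cDyRamRowCellOnShell (uniformizer_letters latticeNearTransvShell_zero_of_row)
open Summit.HodgeConjecture.HodgeConjecture.Cruxes.H413.F0P3cDyRamConeCellPresentation (exists_presentation_of_mem_levelSetDep)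
open Summit.HodgeConjecture.HodgeConjecture.Cruxes.H413.F0P3cDyRamConeLevelTransport (ncard_glueFibre_eq_natCard_normFibre_of_gen exists_map_eq_glueUnit exists_coneData_of_gen)
open Summit.HodgeConjecture.HodgeConjecture.Cruxes.H413.F0P3cDyRamRowCleanCellBit (line_entry_mul_map_eq_one)
open Summit.HodgeConjecture.HodgeConjecture.Cruxes.H413.F0P3cDyRamBeta2ConesRowWindow (isOrd_lam_iff_le)
open Summit.HodgeConjecture.HodgeConjecture.Cruxes.H413.F0P3cDyRamToricLevelCensusRamKAtThirdField (forall_fixed_fixed_exists_mul_theta_eq_of_frame)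
open Summit.HodgeConjecture.HodgeConjecture.Cruxes.H413.F0P3cDyRamConeCellDiagonalSize (levelSetDep_diag_eq_levelSet)
open Summit.HodgeConjecture.HodgeConjecture.Cruxes.H413.F0P3cDyRamDiagonalFixedClassSystems (exists_repr_fixedBall_card)
open Summit.HodgeConjecture.HodgeConjecture.Cruxes.H413.F0P3cDyRamDiagonalCellCoordinates (theta0_letters map_coordAB v_coords_scalar)
open Summit.HodgeConjecture.HodgeConjecture.Cruxes.H413.F0P3cDyRamDiagonalCellAffineLabel (exists_affineLabel_of_coords)
open Summit.HodgeConjecture.HodgeConjecture.Cruxes.H413.F0P3cDyRamDiagonalCellGeneratorIndependence (coords_letters_of_gen cls_iff_cls_and_v_sub_le_of_presentations)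
open Summit.HodgeConjecture.HodgeConjecture.Cruxes.H413.F0P3cDyRamDiagonalCellDigitMap (normSign_affineLabel_eq_of_near exists_preimage_of_fixed)
open Summit.HodgeConjecture.HodgeConjecture.Cruxes.H413.F0P3cDyRamDiagonalCellRowSocket (cellDiff_diag_eq_zero_of_reads)
open Summit.HodgeConjecture.HodgeConjecture.Cruxes.H413.F0P3cDyRamDiagonalCellPopRead (weight_ne_zero_iff_cls_iff_of_gen)
open Summit.HodgeConjecture.HodgeConjecture.Cruxes.H413.F0P3cDyRamDiagonalCellVertexRead (valueSet_eq_xPlus_iff_affineSign)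

/-- **HEAD — «THE DIAGONAL CELL AT `δ = 2`, `d = 2` CONTRIBUTES ZERO»** (‹OFF.letter.v1›'s one-literal general block; the hypothesis shape `hdflat` of ★ `small2_of_term_of_dflat`
VERBATIM; `N` the fence schema with the floor `4 ≤ N`).  ★ K7 ∘ ★ K7b ∘ ★ K7c-A, per vertex through ★ p862869, ★ p863084, ★ K5c, ★ K6b, the literals socketed by the sign of `ε`.
[cite: Kottwitz1986BaseChangeUnits, §1 pp. 240–241] [cite: Rogawski1990, §4.9 Prop. 4.9.1 (b) p. 55] [cite: LabesseLanglands1979, §2 (2.2) p. 9] [cite: Jacobowitz1962, §4] -/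
theorem dflat_two_holds (N : ℕ → ℕ → ℕ → ℕ) (hN : ∀ d tE q : ℕ, 4 ≤ N d tE q) :
      ∀ (E M : Type) [Field E] [Valued E ℤᵐ⁰] [CompleteSpace E] [IsDiscreteValuationRing 𝒪[E]] [Finite 𝓀[E]]
        [Field M] [Valued M ℤᵐ⁰] [CompleteSpace M] [IsDiscreteValuationRing 𝒪[M]] [Finite 𝓀[M]]
        (σ : E →+* E) (ϖ : E) (d tE : ℕ) (_hD : IsRamifiedQuadraticDatum σ ϖ d tE) (_hσσ : ∀ a, σ (σ a) = a) (_h2 : ¬ IsUnit (2 : 𝒪[E]))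
        (jE : E →+* M) (ρ Θ : M →+* M) (α lam : M)
        (_hρρ : ∀ z, ρ (ρ z) = z) (_hvρ : ∀ z, Valued.v (ρ z) = Valued.v z) (_hρj : ∀ a, ρ (jE a) = jE a)
        (_hjv : ∀ a, Valued.v (jE a) ≤ 1 ↔ Valued.v a ≤ 1) (_hjfix : ∀ z : M, ρ z = z ↔ ∃ a, jE a = z) (_hΘj : ∀ a, Θ (jE a) = jE (σ a))
        (_hΘΘ : ∀ z, Θ (Θ z) = z) (_hΘρ : ∀ z, Θ (ρ z) = ρ (Θ z)) (_hvΘ : ∀ z, Valued.v (Θ z) = Valued.v z)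
        (_hα : ρ α ≠ α) (_hα1 : Valued.v α ≤ 1) (_hint : ∀ z : M, Valued.v z ≤ 1 → Valued.v ((z - ρ z) / (α - ρ α)) ≤ 1)
        (_hΘlam : Θ lam * lam = 1) (_hvlam : Valued.v lam = 1) (_hbasis : ∀ z : M, ∃! pq : E × E, z = jE pq.1 + jE pq.2 * lam)
        (_hU : Valued.v (α - ρ α) = 1) (_hτ : Valued.v (α - Θ α) < 1)
        (_hσres : ∀ z : M, ρ z = z → Valued.v z ≤ 1 → Valued.v (Θ z - z) < 1) (_hres : ∀ z : M, Valued.v z ≤ 1 → Valued.v (z - Θ z) < 1)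
        (_hΘne : ∃ x : M, Θ x ≠ x) (_hDM : IsRamifiedQuadraticDatum Θ (jE ϖ) d tE) (_hjiso : ∀ a, Valued.v (jE a) = Valued.v a)
        (_hq : Nat.card 𝓀[M] = Nat.card 𝓀[E] ^ 2) (_hjpow : ∀ (t : E) (n : ℤ), Valued.v (jE t) = Valued.v (jE ϖ) ^ n ↔ Valued.v t = Valued.v ϖ ^ n)
        (_hEval : ∀ c : M, ρ c = c → c ≠ 0 → Valued.v c ≤ 1 → ∃ n : ℕ, Valued.v c = Valued.v (jE ϖ) ^ n)
        (_hϖmax : ∀ t : M, ρ t = t → Valued.v t < 1 → Valued.v t ≤ Valued.v (jE ϖ))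
        (γ₂ : GL (Fin 2) E) (u : GL (Fin 1) E)
        (_hdet : (γ₂ : Matrix (Fin 2) (Fin 2) E).det * σ (γ₂ : Matrix (Fin 2) (Fin 2) E).det = 1)
        (_htr : (γ₂ : Matrix (Fin 2) (Fin 2) E).trace = (γ₂ : Matrix (Fin 2) (Fin 2) E).det * σ (γ₂ : Matrix (Fin 2) (Fin 2) E).trace)
        (_hirr : ∀ x : E, x * x - (γ₂ : Matrix (Fin 2) (Fin 2) E).trace * x + (γ₂ : Matrix (Fin 2) (Fin 2) E).det ≠ 0)
        (_hlam2 : lam * lam = jE (γ₂ : Matrix (Fin 2) (Fin 2) E).trace * lam - jE (γ₂ : Matrix (Fin 2) (Fin 2) E).det)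
        (_hρlam : ρ lam = jE (γ₂ : Matrix (Fin 2) (Fin 2) E).trace - lam) (m jl : ℕ) (_hm : Valued.v (lam - jE ((u : Matrix (Fin 1) (Fin 1) E) 0 0)) = WithZero.exp (-(m : ℤ)))
        (_hjl : Valued.v ((lam - jE ((u : Matrix (Fin 1) (Fin 1) E) 0 0)) - ρ (lam - jE ((u : Matrix (Fin 1) (Fin 1) E) 0 0))) = WithZero.exp (-(jl : ℤ)))
        (_hs : Valued.v ((γ₂ : Matrix (Fin 2) (Fin 2) E).trace - 2) * Valued.v (ϖ ^ (d % 2)) ≤ Valued.v (ϖ ^ mcOfRecord d))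
        (_hp : Valued.v ((γ₂ : Matrix (Fin 2) (Fin 2) E).det - (γ₂ : Matrix (Fin 2) (Fin 2) E).trace + 1) ≤ Valued.v (ϖ ^ mcOfRecord d))
        (_hNm : N d tE (Nat.card 𝓀[E]) ≤ m) (_hu1N : Valued.v (((u : Matrix (Fin 1) (Fin 1) E) 0 0) - 1) ≤ Valued.v (ϖ ^ N d tE (Nat.card 𝓀[E]))) (_hlam1 : Valued.v (lam - 1) ≤ Valued.v (jE ϖ ^ N d tE (Nat.card 𝓀[E])))
        (_hu : Valued.v ((u : Matrix (Fin 1) (Fin 1) E) 0 0) = 1) (_hum : Valued.v (((u : Matrix (Fin 1) (Fin 1) E) 0 0) - 1) ≤ Valued.v (ϖ ^ mstarOfRecord d))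
        (H₂ : Matrix (Fin 2) (Fin 2) E) (hW : E) (_hH₂ : IsUnit H₂.det) (_hH₂σ : (H₂.map σ)ᵀ = H₂) (_hhW : Valued.v hW = 1) (_hhWσ : σ hW = hW)
        (P₁ : GL (Fin 3) E) (_hA : formCongr σ P₁ ((StdForm.antidiagonal 3).over E) = (!![H₂ 0 0, 0, H₂ 0 1; 0, hW, 0; H₂ 1 0, 0, H₂ 1 1] : Matrix (Fin 3) (Fin 3) E))
        (_hΓ : P₁ * endoGL (γ₂, u) * P₁⁻¹ ∈ unitaryGroupOfForm σ ((StdForm.antidiagonal 3).over E))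
        (φ : (Fin 2 → E) →+ M) (h : M) (_hφs : ∀ (c : E) (x : Fin 2 → E), φ (c • x) = jE c * φ x) (_hφi : Function.Injective φ) (_hφo : Function.Surjective φ)
        (_hφγ : ∀ x, φ ((γ₂ : Matrix (Fin 2) (Fin 2) E).mulVec x) = lam * φ x)
        (_hform : ∀ x y, jE (pairing σ H₂ x y) = h * Θ (φ x) * φ y + ρ (h * Θ (φ x) * φ y)) (_hΘh : Θ h = h) (_hh : h ≠ 0)
        (J R : ℕ) (f : ℕ → ℕ → AddSubgroup M → ℕ)
        (_hfinF : {L₃ : Submodule 𝒪[E] (Fin 3 → E) | IsSelfDualLattice σ ϖ (!![H₂ 0 0, 0, H₂ 0 1; 0, hW, 0; H₂ 1 0, 0, H₂ 1 1] : Matrix (Fin 3) (Fin 3) E) L₃ ∧ mapGL (endoGL (γ₂, u)) L₃ = L₃}.Finite)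
        (_hR : ∀ L₃ : Submodule 𝒪[E] (Fin 3 → E), IsSelfDualLattice σ ϖ (!![H₂ 0 0, 0, H₂ 0 1; 0, hW, 0; H₂ 1 0, 0, H₂ 1 1] : Matrix (Fin 3) (Fin 3) E) L₃ →
          mapGL (endoGL (γ₂, u)) L₃ = L₃ → ∀ b : ℕ, (∀ c : E, (Pi.single 1 c : Fin 3 → E) ∈ L₃ ↔ Valued.v c ≤ Valued.v ϖ ^ b) → b ≤ R)
        (_hJ : ¬ IsOrd ρ α (jE ϖ ^ (J + 1)) lam) (_hfinLS : ∀ j a, (levelSet ρ Θ α (jE ϖ) h j a).Finite)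
        (_hf : ∀ (b j : ℕ) (Λ : AddSubgroup M) (x₀ : M) (r : E), 1 ≤ b → x₀ ≠ 0 → (∀ x, x ∈ Λ ↔ ∃ z, IsOrd ρ α (jE ϖ ^ j) z ∧ x = x₀ * z) →
          IsOrd ρ α (jE ϖ ^ j) (dualGen ρ Θ α (jE ϖ ^ j) h x₀) → ¬ IsOrd ρ α (jE ϖ ^ j) (dualGen ρ Θ α (jE ϖ ^ j) h x₀ / jE ϖ) → Valued.v (dualGen ρ Θ α (jE ϖ ^ j) h x₀) = Valued.v (jE ϖ) ^ b →
          (∀ b', (∀ x ∈ Λ, Valued.v (h * Θ x * b' + ρ (h * Θ x * b')) ≤ 1) → (lam - jE ((u : Matrix (Fin 1) (Fin 1) E) 0 0)) * b' ∈ Λ) → IsOrd ρ α (jE ϖ ^ j) lam →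
          jE r = glueUnit ρ Θ α (jE ϖ ^ j) h (jE ϖ) (jE hW) x₀ b →
          f b j Λ = Nat.card {x : 𝒪[E] ⧸ 𝓂[E] ^ (2 * b) // ∃ u' : 𝒪[E], Ideal.Quotient.mk (𝓂[E] ^ (2 * b)) u' = x ∧ Valued.v ((u' : E) * σ u' - r) ≤ Valued.v (ϖ ^ (2 * b))}),
        ∀ b : ℕ, 1 ≤ b → 2 * b = m → d = 2 → tE < m → 4 ≤ m → jl = m + 2 →
                ((∑ᶠ Λ ∈ levelSetDep ρ Θ α (jE ϖ) h b b (lam - jE ((u : Matrix (Fin 1) (Fin 1) E) 0 0)) ∩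
                      {Λ | ∃ B : Submodule 𝒪[E] (Fin 2 → E), B.toAddSubgroup.map φ = Λ ∧
                        ∃ L₃ : Submodule 𝒪[E] (Fin 3 → E), IsSelfDualLattice σ ϖ (!![H₂ 0 0, 0, H₂ 0 1; 0, hW, 0; H₂ 1 0, 0, H₂ 1 1] : Matrix (Fin 3) (Fin 3) E) L₃ ∧
                          L₃ ⊓ LinearMap.ker ((LinearMap.proj (1 : Fin 3) : (Fin 3 → E) →ₗ[E] E).restrictScalars 𝒪[E]) =
                            B.map ((Matrix.toLin' (!![1, 0; 0, 0; 0, 1] : Matrix (Fin 3) (Fin 2) E)).restrictScalars 𝒪[E]) ∧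
                          (∀ c : E, (Pi.single 1 c : Fin 3 → E) ∈ L₃ ↔ Valued.v c ≤ Valued.v ϖ ^ b) ∧
                          (LatticeNearTransvShell ϖ (d % 2) (mstarOfRecord d) ((((endoGL (γ₂, u) : GL (Fin 3) E) : Matrix (Fin 3) (Fin 3) E) - 1)) L₃ ∧
                            {z : E | ∃ y ∈ L₃, Valued.v ((ϖ ^ (mstarOfRecord d))⁻¹ * (z - pairing σ (!![H₂ 0 0, 0, H₂ 0 1; 0, hW, 0; H₂ 1 0, 0, H₂ 1 1] : Matrix (Fin 3) (Fin 3) E) y (((((endoGL (γ₂, u) : GL (Fin 3) E) : Matrix (Fin 3) (Fin 3) E) - 1)) *ᵥ y))) ≤ 1} =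
                              valueSetMod σ ϖ (mstarOfRecord d) (xPlus σ ϖ d))}, f b b Λ : ℕ) : ℤ) -
                  ((∑ᶠ Λ ∈ levelSetDep ρ Θ α (jE ϖ) h b b (lam - jE ((u : Matrix (Fin 1) (Fin 1) E) 0 0)) ∩
                      {Λ | ∃ B : Submodule 𝒪[E] (Fin 2 → E), B.toAddSubgroup.map φ = Λ ∧
                        ∃ L₃ : Submodule 𝒪[E] (Fin 3 → E), IsSelfDualLattice σ ϖ (!![H₂ 0 0, 0, H₂ 0 1; 0, hW, 0; H₂ 1 0, 0, H₂ 1 1] : Matrix (Fin 3) (Fin 3) E) L₃ ∧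
                          L₃ ⊓ LinearMap.ker ((LinearMap.proj (1 : Fin 3) : (Fin 3 → E) →ₗ[E] E).restrictScalars 𝒪[E]) =
                            B.map ((Matrix.toLin' (!![1, 0; 0, 0; 0, 1] : Matrix (Fin 3) (Fin 2) E)).restrictScalars 𝒪[E]) ∧
                          (∀ c : E, (Pi.single 1 c : Fin 3 → E) ∈ L₃ ↔ Valued.v c ≤ Valued.v ϖ ^ b) ∧
                          (LatticeNearTransvShell ϖ (d % 2) (mcOfRecord d) ((((endoGL (γ₂, u) : GL (Fin 3) E) : Matrix (Fin 3) (Fin 3) E) - 1)) L₃ ∧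
                            ¬ {z : E | ∃ y ∈ L₃, Valued.v ((ϖ ^ (mstarOfRecord d))⁻¹ * (z - pairing σ (!![H₂ 0 0, 0, H₂ 0 1; 0, hW, 0; H₂ 1 0, 0, H₂ 1 1] : Matrix (Fin 3) (Fin 3) E) y (((((endoGL (γ₂, u) : GL (Fin 3) E) : Matrix (Fin 3) (Fin 3) E) - 1)) *ᵥ y))) ≤ 1} =
                              valueSetMod σ ϖ (mstarOfRecord d) (xPlus σ ϖ d))}, f b b Λ : ℕ) : ℤ) = 0 := by
  intro E M _ _ _ _ _ _ _ _ _ _ σ ϖ d tE hD hσσ h2 jE ρ Θ α lam hρρ hvρ hρj hjv hjfix hΘj hΘΘ hΘρ hvΘ hα hα1 hint hΘlam hvlam hbasis hU hτ hσres hres hΘne hDM hjiso hq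
    hjpow hEval hϖmax γ₂ u hdet htr hirr hlam2 hρlam m jl hm hjl hs hp hNm hu1N hlam1 hu hum H₂ hW hH₂ hH₂σ hhW hhWσ P₁ hA hΓ φ h hφs hφi hφo hφγ hform hΘh hh
    J R f hfinF hR hJ hfinLS hf b hb hbm hd2 htE h4m hjlm
  -- E-side letters
  obtain ⟨-, hvσ, hϖ, hfixE, hdd, hd1, h2t⟩ := id hD
  haveI := isAdicComplete_valuedInteger_of_completeSpace (K := E) hϖ
  obtain ⟨hϖ0, hϖlt, hjϖ0, hvjϖ0, -, hjϖlt, hjϖle⟩ := uniformizer_letters jE hjv hϖ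
  have h2v : Valued.v (2 : E) < 1 := by exact_mod_cast Valuation.Integer.not_isUnit_iff_valuation_lt_one.mp h2
  have hϖM : Valued.v (jE ϖ) = exp (-1 : ℤ) := by rw [hjiso, hϖ]
  have hπn : ∀ n : ℕ, Valued.v (jE ϖ) ^ n = exp (-(n : ℤ)) := fun n => by rw [hϖM, ← exp_nsmul, nsmul_eq_mul, mul_neg, mul_one]
  have hρϖ : ρ (jE ϖ) = jE ϖ := hρj ϖ
  have hW0 : hW ≠ 0 := fun h0 => by rw [h0, map_zero] at hhW; exact zero_ne_one hhW
  have hd0 : d % 2 = 0 := by omega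
  have hdt : d ≤ tE + 1 := d_le_succ_t hσσ hfixE hϖ hdd h2t
  have huu := line_entry_mul_map_eq_one σ hW0 hA hΓ
  have hlamb : IsOrd ρ α (jE ϖ ^ b) lam := (isOrd_lam_iff_le hD hρj hvlam hU hjiso hjl b).2 (by omega)
  have hdb : d ≤ b := by omega
  have h2b : 2 * b ≤ m := by omega
  have hgd : 1 + 1 ≤ d := by omega
  have hmb : mstarOfRecord d ≤ 2 * b := by simp only [mstarOfRecord]; omega
  have hmg : mstarOfRecord d ≤ b + 2 * 1 := by simp only [mstarOfRecord]; omega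
  have hn4 : 3 * d - 2 + d % 2 ≤ 4 := by omega
  have hn4' : 4 ≤ 2 * b + 2 * 1 := by omega
  have hlam4 : Valued.v (lam - 1) ≤ Valued.v (jE ϖ) ^ 4 := by
    refine hlam1.trans ?_
    rw [Valuation.map_pow]; exact pow_le_pow_right_of_le_one' hjϖle (hN d tE _)
  have hu4 : Valued.v ((u : Matrix (Fin 1) (Fin 1) E) 0 0 - 1) ≤ Valued.v ϖ ^ 4 := by
    refine hu1N.trans ?_
    rw [Valuation.map_pow]; exact pow_le_pow_right_of_le_one' hϖlt.le (hN d tE _)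
  have hum' : Valued.v ((u : Matrix (Fin 1) (Fin 1) E) 0 0 - 1) ≤ Valued.v ϖ ^ mstarOfRecord d := by rwa [Valuation.map_pow] at hum
  have hm2b : Valued.v (lam - jE ((u : Matrix (Fin 1) (Fin 1) E) 0 0)) = Valued.v (jE ϖ) ^ (2 * b) := by
    rw [hπn, show ((2 * b : ℕ) : ℤ) = m by exact_mod_cast hbm]; exact hm
  have hjl2 : Valued.v ((lam - jE ((u : Matrix (Fin 1) (Fin 1) E) 0 0)) - ρ (lam - jE ((u : Matrix (Fin 1) (Fin 1) E) 0 0))) = Valued.v (jE ϖ) ^ (2 * b + 2 * 1) := by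
    rw [hπn, show ((2 * b + 2 * 1 : ℕ) : ℤ) = jl by push_cast; omega]; exact hjl
  have hcb : Valued.v (jE ϖ ^ b) ≤ Valued.v (jE ϖ) ^ b := by rw [Valuation.map_pow]
  have hanti : Valued.v ((lam - jE ((u : Matrix (Fin 1) (Fin 1) E) 0 0)) - ρ (lam - jE ((u : Matrix (Fin 1) (Fin 1) E) 0 0))) ≤
      Valued.v (jE ϖ ^ b * (α - ρ α)) * Valued.v (jE ϖ) ^ (b + 1) := by
    rw [hjl2, Valuation.map_mul, Valuation.map_pow, hU]; simp only [mul_one]; rw [← pow_add]; exact pow_le_pow_right_of_le_one' hjϖle (by omega)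
  have hfin : (levelSet ρ Θ α (jE ϖ) h b b).Finite := hfinLS b b
  -- M-side frame letters: `hFN`, `|2| < 1`, the pivot `θ₀ := αΘα`
  have hFN := forall_fixed_fixed_exists_mul_theta_eq_of_frame hρρ hvρ hΘρ hα1 hU hDM hq hσres hτ
  have h2M : Valued.v (2 : M) < 1 := by have e := hjiso 2; rw [map_ofNat] at e; rw [e]; exact h2v
  obtain ⟨hΘθ₀, hθ1, hθρ⟩ := theta0_letters (ρ := ρ) hvρ hΘΘ hvΘ hα1 hU hτ h2M
  have hθ₀ : ρ (α * Θ α) ≠ α * Θ α := fun h0 => by rw [h0, sub_self, map_zero] at hθρ; exact zero_ne_one hθρ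
  -- the coordinates `â, b̂` of `μ̂` and the affine letters (★ K3, ★ K4)
  obtain ⟨hρB, hρA⟩ := map_coordAB hρρ hθ₀ ((lam - jE ((u : Matrix (Fin 1) (Fin 1) E) 0 0)) / (jE ϖ * Θ (jE ϖ)) ^ b)
  obtain ⟨bh, hbh⟩ := (hjfix _).1 hρB
  obtain ⟨â, hâ⟩ := (hjfix _).1 hρA
  obtain ⟨-, hBv, hAv⟩ := v_coords_scalar (ρ := ρ) (Θ := Θ) (α := α) (θ₀ := α * Θ α) (b := b) (g := 1) hΘρ hvΘ hρϖ hϖM hθ1 hθρ hU hm2b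
    (by rw [Valuation.map_mul, Valuation.map_pow, hU, mul_one]; exact hjl2) le_rfl
  have hâ1 : Valued.v â = 1 := by rw [← hjiso, hâ]; exact hAv
  have hbh2 : Valued.v bh = Valued.v ϖ ^ (2 * 1) := by rw [← hjiso, hbh, hBv, hjiso]
  obtain ⟨α₁, γ₁, hσα, hα1', hσγ, hγ, haff⟩ := exists_affineLabel_of_coords hD hd0 hâ1 hbh2 le_rfl
  have hγ1 : Valued.v γ₁ < 1 := by rw [hγ]; exact pow_lt_one₀ zero_le hϖlt (by omega)
  -- digit systems (★ `exists_repr_fixedBall_card` at level `0`)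
  obtain ⟨Rd, hRd1, hRd2, hRd3, -⟩ := exists_repr_fixedBall_card hσσ hvσ hfixE hϖ hdd (2 * d) 0
  obtain ⟨R', hR'1, hR'2, hR'3, -⟩ := exists_repr_fixedBall_card hσσ hvσ hfixE hϖ hdd (2 * (d - 1)) 0
  simp only [mul_zero, pow_zero, add_zero] at hRd1 hRd2 hRd3 hR'1 hR'2 hR'3
  -- the deep letter through `jE` (for ★ K5c)
  have hdeep : ∀ u' : M, ρ u' = u' → Θ u' = u' → Valued.v (u' - 1) ≤ Valued.v (jE ϖ) ^ (2 * d) → ∃ c : M, ρ c = c ∧ c * Θ c = u' := by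
    intro u' hρu hΘu hu1
    obtain ⟨ue, rfl⟩ := (hjfix u').1 hρu
    have hσue : σ ue = ue := jE.injective (by rw [← hΘj, hΘu])
    have hue1 : Valued.v (ue - 1) ≤ Valued.v ϖ ^ (2 * d) := by rw [← hjiso, map_sub, map_one, ← hjiso ϖ]; exact hu1
    obtain ⟨z, hz⟩ := exists_mul_map_eq_of_fixed_of_v_sub_one_le_pred hD hσue (n := 2 * d) (by omega) hue1
    exact ⟨jE z, hρj z, by rw [hΘj, ← map_mul, hz]⟩
  -- «class ⟺ sign»: `(∃ c, ρc = c ∧ cΘc = T) ↔ ω(T̂) = 1` for `jE T̂ = T`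
  have hclsiff : ∀ (T : M) (Tx : E), jE Tx = T → ((∃ c : M, ρ c = c ∧ c * Θ c = T) ↔ normSign σ Tx = 1) := by
    intro T Tx hTx
    constructor
    · rintro ⟨c, hρc, hc⟩
      obtain ⟨z, rfl⟩ := (hjfix c).1 hρc
      exact normSign_of_isNorm σ ⟨z, jE.injective (by rw [map_mul, ← hΘj, hc, hTx])⟩
    · intro h1
      have hz : ∃ z : E, z * σ z = Tx := by
        by_contra hno
        rw [normSign_of_not_isNorm σ hno] at h1
        norm_num at h1
      obtain ⟨z, hz⟩ := hz
      exact ⟨jE z, hρj z, by rw [hΘj, ← map_mul, hz, hTx]⟩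
  -- (hP): the populatedness read (★ K7b)
  have hPread := weight_ne_zero_iff_cls_iff_of_gen σ hσσ hvσ hϖ hD h2v hH₂σ hhW hhWσ jE hρρ hvρ hα hα1 hint hΘΘ hΘρ hvΘ hΘj hjv hjfix hjpow hϖmax φ hφs hφi hφo
    hφγ hvlam hΘh hh hform ((u : Matrix (Fin 1) (Fin 1) E) 0 0) hb hdb hlamb f hf hm hjl h2b hU hjiso hDM hΘθ₀ hθ1 hθρ hτ hmb
  -- every weighted member has a glued vertex (★ `ncard_glueFibre_eq_natCard_normFibre_of_gen` + `hf`, as in LH4-p06's MASTER)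
  have hglue : ∀ (Λ : AddSubgroup M) (x₀ : M), (x₀ ≠ 0 ∧ (∀ x, x ∈ Λ ↔ ∃ ζ, IsOrd ρ α (jE ϖ ^ b) ζ ∧ x = x₀ * ζ) ∧
        IsOrd ρ α (jE ϖ ^ b) (dualGen ρ Θ α (jE ϖ ^ b) h x₀) ∧ ¬ IsOrd ρ α (jE ϖ ^ b) (dualGen ρ Θ α (jE ϖ ^ b) h x₀ / jE ϖ) ∧
        Valued.v (dualGen ρ Θ α (jE ϖ ^ b) h x₀) = Valued.v (jE ϖ) ^ b) → f b b Λ ≠ 0 → ∃ B : Submodule 𝒪[E] (Fin 2 → E), B.toAddSubgroup.map φ = Λ ∧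
      ∃ L₃ : Submodule 𝒪[E] (Fin 3 → E), IsSelfDualLattice σ ϖ (!![H₂ 0 0, 0, H₂ 0 1; 0, hW, 0; H₂ 1 0, 0, H₂ 1 1] : Matrix (Fin 3) (Fin 3) E) L₃ ∧
        L₃ ⊓ LinearMap.ker ((LinearMap.proj (1 : Fin 3) : (Fin 3 → E) →ₗ[E] E).restrictScalars 𝒪[E]) =
          B.map ((Matrix.toLin' (!![1, 0; 0, 0; 0, 1] : Matrix (Fin 3) (Fin 2) E)).restrictScalars 𝒪[E]) ∧
        (∀ c : E, (Pi.single 1 c : Fin 3 → E) ∈ L₃ ↔ Valued.v c ≤ Valued.v ϖ ^ b) := by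
    rintro Λ x₀ ⟨hx₀, hΛx, hyO, hyprim, hylev⟩ hfne
    have hΛ : Λ ∈ levelSetDep ρ Θ α (jE ϖ) h b b (lam - jE ((u : Matrix (Fin 1) (Fin 1) E) 0 0)) := by
      rw [levelSetDep_diag_eq_levelSet hρρ hvρ hΘΘ hΘρ hvΘ hα1 hU hρϖ hϖM hh hm hjl hb h2b]; exact ⟨x₀, hx₀, hΛx, hyO, hyprim, hylev⟩
    have hdepΛ := hΛ.2
    obtain ⟨B, hBΛ, -, -, w₀, -, -, -, -, -⟩ := exists_coneData_of_gen σ hϖ0 hϖlt H₂ jE hρρ hvρ hα hα1 hint hΘΘ hΘρ hvΘ hjv hjfix hjpow hϖmax φ hφs hφi hφo hφγ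
      hvlam hΘh hh hform ((u : Matrix (Fin 1) (Fin 1) E) 0 0) hb hx₀ hΛx hyO hyprim hylev hdepΛ hlamb
    subst hBΛ
    obtain ⟨r, hr⟩ := exists_map_eq_glueUnit (ρ := ρ) (Θ := Θ) (α := α) jE hρρ hΘρ hjfix (jE ϖ ^ b) h x₀ ϖ hW b
    have hcount := ncard_glueFibre_eq_natCard_normFibre_of_gen σ hσσ hvσ hϖ hH₂ hH₂σ hhW hhWσ jE hρρ hvρ hα hα1 hint hΘΘ hΘρ hvΘ hΘj hjv hjfix hjpow hϖmax φ hφs hφi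
      hφo hφγ hvlam hΘh hh hform ((u : Matrix (Fin 1) (Fin 1) E) 0 0) hb hx₀ hΛx hyO hyprim hylev hdepΛ hlamb hr
    rw [hf b b _ x₀ r hb hx₀ hΛx hyO hyprim hylev hdepΛ hlamb hr, ← hcount] at hfne
    obtain ⟨L₃, hL, hLB, htube⟩ := Set.nonempty_of_ncard_ne_zero hfne
    exact ⟨B, rfl, L₃, hL, hLB, htube⟩
  -- PER VERTEX: both shells, and the value-set read in the letters of the GIVEN generator `x₀`
  have hvert : ∀ (Λ : AddSubgroup M) (x₀ : M), (x₀ ≠ 0 ∧ (∀ x, x ∈ Λ ↔ ∃ ζ, IsOrd ρ α (jE ϖ ^ b) ζ ∧ x = x₀ * ζ) ∧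
        IsOrd ρ α (jE ϖ ^ b) (dualGen ρ Θ α (jE ϖ ^ b) h x₀) ∧ ¬ IsOrd ρ α (jE ϖ ^ b) (dualGen ρ Θ α (jE ϖ ^ b) h x₀ / jE ϖ) ∧
        Valued.v (dualGen ρ Θ α (jE ϖ ^ b) h x₀) = Valued.v (jE ϖ) ^ b) → f b b Λ ≠ 0 → ∀ (Vh : E), jE Vh = ((α * Θ α * ((((α - ρ α) * Θ (α - ρ α)) * (h * (x₀ * Θ x₀)))⁻¹) + ρ (α * Θ α * ((((α - ρ α) * Θ (α - ρ α)) * (h * (x₀ * Θ x₀)))⁻¹))) / (((((α - ρ α) * Θ (α - ρ α)) * (h * (x₀ * Θ x₀)))⁻¹) + ρ ((((α - ρ α) * Θ (α - ρ α)) * (h * (x₀ * Θ x₀)))⁻¹))) →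
      ∀ (B : Submodule 𝒪[E] (Fin 2 → E)) (L₃ : Submodule 𝒪[E] (Fin 3 → E)),
      B.toAddSubgroup.map φ = Λ → IsSelfDualLattice σ ϖ (!![H₂ 0 0, 0, H₂ 0 1; 0, hW, 0; H₂ 1 0, 0, H₂ 1 1] : Matrix (Fin 3) (Fin 3) E) L₃ →
      L₃ ⊓ LinearMap.ker ((LinearMap.proj (1 : Fin 3) : (Fin 3 → E) →ₗ[E] E).restrictScalars 𝒪[E]) =
        B.map ((Matrix.toLin' (!![1, 0; 0, 0; 0, 1] : Matrix (Fin 3) (Fin 2) E)).restrictScalars 𝒪[E]) →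
      (∀ c : E, (Pi.single 1 c : Fin 3 → E) ∈ L₃ ↔ Valued.v c ≤ Valued.v ϖ ^ b) →
      (∀ k : ℕ, k ≤ 2 * b → k ≤ 2 * mstarOfRecord d → k ≤ b + 1 + mstarOfRecord d → k ≤ tE + mstarOfRecord d →
          LatticeNearTransvShell ϖ 0 k ((((endoGL (γ₂, u) : GL (Fin 3) E) : Matrix (Fin 3) (Fin 3) E) - 1)) L₃) ∧
      ({z : E | ∃ y ∈ L₃, Valued.v ((ϖ ^ mstarOfRecord d)⁻¹ * (z - pairing σ (!![H₂ 0 0, 0, H₂ 0 1; 0, hW, 0; H₂ 1 0, 0, H₂ 1 1] : Matrix (Fin 3) (Fin 3) E) y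
          ((((endoGL (γ₂, u) : GL (Fin 3) E) : Matrix (Fin 3) (Fin 3) E) - 1) *ᵥ y))) ≤ 1} = valueSetMod σ ϖ (mstarOfRecord d) (xPlus σ ϖ d) ↔
        (normSign σ (α₁ + γ₁ * Vh) = 1 ↔ ∃ z : E, z * σ z = -hW)) := by
    rintro Λ x₀ ⟨hx₀, hΛx, hyO, hyprim, hylev⟩ hfne Vh hVh B L₃ hBΛ hL hLB htube
    have hΛ : Λ ∈ levelSetDep ρ Θ α (jE ϖ) h b b (lam - jE ((u : Matrix (Fin 1) (Fin 1) E) 0 0)) := by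
      rw [levelSetDep_diag_eq_levelSet hρρ hvρ hΘΘ hΘρ hvΘ hα1 hU hρϖ hϖM hh hm hjl hb h2b]; exact ⟨x₀, hx₀, hΛx, hyO, hyprim, hylev⟩
    obtain ⟨x₁, w₀, g₀, hx₁, hΛx₁, hyO₁, hyp₁, hylev₁, hw₀Y, hpr, hg₀, hg₀1, hprg⟩ :=
      exists_presentation_of_mem_levelSetDep σ hσσ hvσ hϖ hH₂ hH₂σ hhW jE hρρ hvρ hα hα1 hint hΘΘ hΘρ hvΘ hjv hjfix hjpow hϖmax φ hφs hφi hφo hφγ hvlam hΘh hh hform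
        ((u : Matrix (Fin 1) (Fin 1) E) 0 0) hb hlamb hΛ hBΛ hL hLB htube
    have hintL : ∀ y ∈ L₃, Valued.v (pairing σ (!![H₂ 0 0, 0, H₂ 0 1; 0, hW, 0; H₂ 1 0, 0, H₂ 1 1] : Matrix (Fin 3) (Fin 3) E) y y) ≤ 1 :=
      fun y hy => (mem_dualLatt σ _ L₃ y).1 (le_dualLatt_of_isVertexLattice hvσ hL hy) y hy
    refine ⟨fun k hk1 hk2 hk3 hk4 => latticeNearTransvShell_zero_of_row hvρ hα hα1 hϖ (le_of_eq h2t) jE hjv hjfix φ hφs hφi hφγ htube hpr hLB.symm hg₀ hg₀1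
      hprg hBΛ hx₁ hΛx₁ hw₀Y hyO₁ hyp₁ hb hylev₁ hcb u hum' hm2b hanti hk1 hk2 hk3 hk4, ?_⟩
    -- the coordinates of `x₁`, their preimages, the read (★ K7c-A)
    obtain ⟨-, -, -, hT₁v, hρT₁, hΘT₁, hρV₁, hΘV₁, hV₁1, -⟩ := coords_letters_of_gen hρρ hvρ hΘΘ hΘρ hvΘ hU hτ hΘh hρϖ hϖM hΘθ₀ hθ1 hθρ hb hyp₁ hylev₁
    obtain ⟨Th1, hTh1, -, -⟩ := exists_preimage_of_fixed jE hjiso hjfix hΘj hρT₁ hΘT₁ hT₁v.le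
    obtain ⟨Vh1, hVh1, hσVh1, hVh11⟩ := exists_preimage_of_fixed jE hjiso hjfix hΘj hρV₁ hΘV₁ hV₁1
    have hread := valueSet_eq_xPlus_iff_affineSign hD hd0 H₂ hW jE hjv hjfix hjiso hρρ hvρ hα hα1 hint hΘΘ hΘρ hvΘ hΘj hU hτ φ hφs hφγ hh hΘh hform hpr hintL
      hLB.symm hg₀ hg₀1 hprg u hx₁ hBΛ hΛx₁ hw₀Y hyO₁ hyp₁ hylev₁ hΛ.2 hΘlam hvlam huu le_rfl hb hmb hmg hm2b hjl2 hn4 hn4' hlam4 hu4 hΘθ₀ hθ1 hθρ hâ hbh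
      haff hTh1 hVh1
    -- the class of `T(x₁)` is `ε` (★ K7b at `x₁`), as a sign
    have hs : normSign σ Th1 = 1 ↔ ∃ z : E, z * σ z = -hW :=
      (hclsiff _ Th1 hTh1).symm.trans ((hPread Λ x₁ ⟨hx₁, hΛx₁, hyO₁, hyp₁, hylev₁⟩).1 hfne)
    -- the digit of `x₁` is the digit of `x₀` (★ K5c), so the affine signs agree (★ K6b)
    obtain ⟨-, -, -, -, -, -, hρV₀, hΘV₀, hV₀1, -⟩ := coords_letters_of_gen hρρ hvρ hΘΘ hΘρ hvΘ hU hτ hΘh hρϖ hϖM hΘθ₀ hθ1 hθρ hb hyprim hylev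
    have hσVh : σ Vh = Vh := jE.injective (by rw [← hΘj, hVh, hΘV₀])
    have hnear := (cls_iff_cls_and_v_sub_le_of_presentations hρρ hvρ hΘΘ hΘρ hvΘ hU hα1 hτ hΘh hρϖ hDM hΘθ₀ hθ1 hθρ hdb hmb hdeep hx₁ hΛx₁ hΛx hyp₁ hylev₁).2
    have haffeq : normSign σ (α₁ + γ₁ * Vh) = normSign σ (α₁ + γ₁ * Vh1) :=
      normSign_affineLabel_eq_of_near hD hσα hα1' hσγ hγ1 hσVh1 hVh11 hσVh (by rw [← hjiso, map_sub, hVh, hVh1, ← hjiso ϖ]; exact hnear)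
    rw [hread, haffeq]
    rcases normSign_eq_one_or σ Th1 with h1 | h1 <;> rcases normSign_eq_one_or σ (α₁ + γ₁ * Vh1) with h3 | h3
    · have hε : ∃ z : E, z * σ z = -hW := hs.1 h1
      rw [h1, h3]; simp [hε]
    · have hε : ∃ z : E, z * σ z = -hW := hs.1 h1
      rw [h1, h3]; simp [hε]
    · have hε : ¬ ∃ z : E, z * σ z = -hW := fun he => by rw [hs.2 he] at h1; norm_num at h1
      rw [h1, h3]; simp [hε]
    · have hε : ¬ ∃ z : E, z * σ z = -hW := fun he => by rw [hs.2 he] at h1; norm_num at h1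
      rw [h1, h3]; simp [hε]
  -- shell arithmetic at `d = 2`
  have hkm : mstarOfRecord d ≤ 2 * b ∧ mstarOfRecord d ≤ 2 * mstarOfRecord d ∧ mstarOfRecord d ≤ b + 1 + mstarOfRecord d ∧ mstarOfRecord d ≤ tE + mstarOfRecord d := by
    simp only [mstarOfRecord]; omega
  have hkc : mcOfRecord d ≤ 2 * b ∧ mcOfRecord d ≤ 2 * mstarOfRecord d ∧ mcOfRecord d ≤ b + 1 + mstarOfRecord d ∧ mcOfRecord d ≤ tE + mstarOfRecord d := by
    simp only [mcOfRecord, mstarOfRecord]; omega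
  -- a preimage of `V(x₀)` for any generator
  have hpre : ∀ (Λ : AddSubgroup M) (x₀ : M), (x₀ ≠ 0 ∧ (∀ x, x ∈ Λ ↔ ∃ ζ, IsOrd ρ α (jE ϖ ^ b) ζ ∧ x = x₀ * ζ) ∧
        IsOrd ρ α (jE ϖ ^ b) (dualGen ρ Θ α (jE ϖ ^ b) h x₀) ∧ ¬ IsOrd ρ α (jE ϖ ^ b) (dualGen ρ Θ α (jE ϖ ^ b) h x₀ / jE ϖ) ∧
        Valued.v (dualGen ρ Θ α (jE ϖ ^ b) h x₀) = Valued.v (jE ϖ) ^ b) → ∃ Vh : E, jE Vh = ((α * Θ α * ((((α - ρ α) * Θ (α - ρ α)) * (h * (x₀ * Θ x₀)))⁻¹) + ρ (α * Θ α * ((((α - ρ α) * Θ (α - ρ α)) * (h * (x₀ * Θ x₀)))⁻¹))) / (((((α - ρ α) * Θ (α - ρ α)) * (h * (x₀ * Θ x₀)))⁻¹) + ρ ((((α - ρ α) * Θ (α - ρ α)) * (h * (x₀ * Θ x₀)))⁻¹))) := by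
    rintro Λ x₀ ⟨hx₀, hΛx, hyO, hyprim, hylev⟩
    obtain ⟨-, -, -, -, -, -, hρV₀, hΘV₀, hV₀1, -⟩ := coords_letters_of_gen hρρ hvρ hΘΘ hΘρ hvΘ hU hτ hΘh hρϖ hϖM hΘθ₀ hθ1 hθρ hb hyprim hylev
    obtain ⟨Vh, hVh, -, -⟩ := exists_preimage_of_fixed jE hjiso hjfix hΘj hρV₀ hΘV₀ hV₀1
    exact ⟨Vh, hVh⟩
  -- ASSEMBLY through ★ K7, the literals socketed by the sign of `ε`
  by_cases hε : ∃ z : E, z * σ z = -hW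
  · refine cellDiff_diag_eq_zero_of_reads σ hσσ hvσ hϖ hD h2v hH₂σ hhW hhWσ jE hρρ hvρ hα hα1 hint hΘΘ hΘρ hvΘ hΘj hjv hjfix hjpow hϖmax φ hφs hφi hφo hφγ hvlam hΘh
      hh hform ((u : Matrix (Fin 1) (Fin 1) E) 0 0) hb hdb hlamb f hf hm hjl h2b hU hjiso hDM h2M hFN hΘθ₀ hθ1 hθρ hτ hmb hσα hα1' hσγ hγ le_rfl hgd Rd hRd1 hRd2 hRd3
      R' hR'1 hR'2 hR'3 hfin _ _ _ hPread ?_ ?_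
    · intro Λ x₀ hG hfne
      constructor
      · rintro ⟨B, hBΛ, L₃, hL, hLB, htube, -, hVS⟩
        obtain ⟨Vh, hVh⟩ := hpre Λ x₀ hG
        exact ⟨Vh, hVh, (((hvert Λ x₀ hG hfne Vh hVh B L₃ hBΛ hL hLB htube).2).1 hVS).2 hε⟩
      · rintro ⟨Vh, hVh, hlab⟩
        obtain ⟨B, hBΛ, L₃, hL, hLB, htube⟩ := hglue Λ x₀ hG hfne
        obtain ⟨hsh, hbit⟩ := hvert Λ x₀ hG hfne Vh hVh B L₃ hBΛ hL hLB htube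
        refine ⟨B, hBΛ, L₃, hL, hLB, htube, ?_, hbit.2 ⟨fun _ => hε, fun _ => hlab⟩⟩
        rw [hd0]; exact hsh _ hkm.1 hkm.2.1 hkm.2.2.1 hkm.2.2.2
    · intro Λ x₀ hG hfne
      constructor
      · rintro ⟨B, hBΛ, L₃, hL, hLB, htube, -, hVS⟩
        obtain ⟨Vh, hVh⟩ := hpre Λ x₀ hG
        exact ⟨Vh, hVh, fun hlab => hVS (((hvert Λ x₀ hG hfne Vh hVh B L₃ hBΛ hL hLB htube).2).2 ⟨fun _ => hε, fun _ => hlab⟩)⟩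
      · rintro ⟨Vh, hVh, hlab⟩
        obtain ⟨B, hBΛ, L₃, hL, hLB, htube⟩ := hglue Λ x₀ hG hfne
        obtain ⟨hsh, hbit⟩ := hvert Λ x₀ hG hfne Vh hVh B L₃ hBΛ hL hLB htube
        refine ⟨B, hBΛ, L₃, hL, hLB, htube, ?_, fun hVS => hlab ((hbit.1 hVS).2 hε)⟩
        rw [hd0]; exact hsh _ hkc.1 hkc.2.1 hkc.2.2.1 hkc.2.2.2
  · rw [← neg_sub, neg_eq_zero]
    refine cellDiff_diag_eq_zero_of_reads σ hσσ hvσ hϖ hD h2v hH₂σ hhW hhWσ jE hρρ hvρ hα hα1 hint hΘΘ hΘρ hvΘ hΘj hjv hjfix hjpow hϖmax φ hφs hφi hφo hφγ hvlam hΘh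
      hh hform ((u : Matrix (Fin 1) (Fin 1) E) 0 0) hb hdb hlamb f hf hm hjl h2b hU hjiso hDM h2M hFN hΘθ₀ hθ1 hθρ hτ hmb hσα hα1' hσγ hγ le_rfl hgd Rd hRd1 hRd2 hRd3
      R' hR'1 hR'2 hR'3 hfin _ _ _ hPread ?_ ?_
    · intro Λ x₀ hG hfne
      constructor
      · rintro ⟨B, hBΛ, L₃, hL, hLB, htube, -, hVS⟩
        obtain ⟨Vh, hVh⟩ := hpre Λ x₀ hG
        refine ⟨Vh, hVh, ?_⟩
        by_contra hlab
        exact hVS (((hvert Λ x₀ hG hfne Vh hVh B L₃ hBΛ hL hLB htube).2).2 ⟨fun h1 => absurd h1 hlab, fun he => absurd he hε⟩)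
      · rintro ⟨Vh, hVh, hlab⟩
        obtain ⟨B, hBΛ, L₃, hL, hLB, htube⟩ := hglue Λ x₀ hG hfne
        obtain ⟨hsh, hbit⟩ := hvert Λ x₀ hG hfne Vh hVh B L₃ hBΛ hL hLB htube
        refine ⟨B, hBΛ, L₃, hL, hLB, htube, ?_, fun hVS => hε ((hbit.1 hVS).1 hlab)⟩
        rw [hd0]; exact hsh _ hkc.1 hkc.2.1 hkc.2.2.1 hkc.2.2.2
    · intro Λ x₀ hG hfne
      constructor
      · rintro ⟨B, hBΛ, L₃, hL, hLB, htube, -, hVS⟩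
        obtain ⟨Vh, hVh⟩ := hpre Λ x₀ hG
        exact ⟨Vh, hVh, fun hlab => hε ((((hvert Λ x₀ hG hfne Vh hVh B L₃ hBΛ hL hLB htube).2).1 hVS).1 hlab)⟩
      · rintro ⟨Vh, hVh, hlab⟩
        obtain ⟨B, hBΛ, L₃, hL, hLB, htube⟩ := hglue Λ x₀ hG hfne
        obtain ⟨hsh, hbit⟩ := hvert Λ x₀ hG hfne Vh hVh B L₃ hBΛ hL hLB htube
        refine ⟨B, hBΛ, L₃, hL, hLB, htube, ?_, hbit.2 ⟨fun h1 => absurd h1 hlab, fun he => absurd he hε⟩⟩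
        rw [hd0]; exact hsh _ hkm.1 hkm.2.1 hkm.2.2.1 hkm.2.2.2

end Summit.HodgeConjecture.HodgeConjecture.Cruxes.H413.F0P3cDyRamDiagonalCellDflatTwo

end
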